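import Summits.CriticalPhenomena.PercolationContinuityZ3.Theorems.FK.PressureBetaConvexity
import Summits.CriticalPhenomena.PercolationContinuityZ3.Theorems.FK.LatticeEdgeCounting
import Literature.Probability.LatticeModels.IsingThermodynamicsProofs
import HarnessLib

/-!
# ELEMENTARY TWO-SIDED BOUNDS ON THE ISING PRESSURE: `β(d + |h|) ≤ ψ(β,h) ≤ βd + log(2 cosh βh)`,
# AND THE SATURATION / ZERO-TEMPERATURE ASYMPTOTICS `ψ(β,h) − β(d + |h|) → 0`
# AS `|h| → ∞` (`β > 0`) AND AS `β → ∞` (`h ≠ 0`), `ψ(β,h)/β → d + |h|`, `f(β,h) → −(d + |h|)`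
# (Friedli–Velenik 2017, Thm. 3.6 (proof), Exercise 3.3, §3.2.1)

Claimed R42 (8)(c) in the cell INBOX at 2026-08-29T04:00:50Z by fkp-10a gen 358 (NEW CLAIM #1 of the gen), addressed to coordinator fk-4 (next seated gen; gen 288 closed l.8706, (ι) in force); lineage row FO-10a-g358 (self-suggested), package g358-surface, label PS-A.
Helper file of the `fk-continuity` build cell (bschramm lane; `--supports stmt-CriticalPhenomena-4575`); builds on
p205010 (kernel theorem, internal audit signed; external expert review pending). No definitions, no named facts, no
sorries; standard axioms. UNCONDITIONAL (nearest-neighbour Ising model on `ℤ^d`, every `d`; the tree's parametrisation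
`exp(β Σ_e σ_e + βh Σ_x σ_x)`).

Finite volume (any locally finite graph `G`, volume `Λ`, boundary condition `bc`):
* `exp_mul_le_isingPartitionFunction_free` — the aligned configuration: `exp(β(|E_Λ| + |h||Λ|)) ≤ Z^∅_{Λ;β,h}` (all real
  `β`, `h`);
* `isingPartitionFunction_le_exp_mul_cosh_pow` — `Z^{bc}_{Λ;β,h} ≤ e^{|β||ℰ^{bc}_Λ|} (2 cosh βh)^{|Λ|}` (drop the
  interaction, keep the field exactly: `Σ_τ Π_x e^{βh τ_x} = (2 cosh βh)^{|Λ|}`);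
* `isingPartitionFunction_zero_beta` — `Z^{bc}_{Λ;0,h} = 2^{|Λ|}` (whence `ψ(0,h) = log 2`, the tree's `pressure_zero_beta`).

Infinite volume (`ψ(β,h) = pressure d β h`, the box limit, tree theorem `hasBoxLimit_pressureIn_holds`), using
`|E_{Λ_N}|/|Λ_N| → d` and `|E_Λ| ≤ d|Λ|` (`LatticeEdgeCounting`):
* `tendsto_pressure_nhds_zero_beta` — `ψ(β,h) → log 2` as `β → 0`;
* **`mul_add_abs_le_pressure`** — `β(d + |h|) ≤ ψ(β,h)` (all real `β`, `h`);
* **`pressure_le_add_log_cosh`** — `ψ(β,h) ≤ |β| d + log(2 cosh(βh))`; with `log(2 cosh x) = |x| + log(1 + e^{−2|x|})`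
  (`log_two_mul_cosh_eq_abs_add`): **`pressure_sub_mem_Icc`** — `0 ≤ ψ(β,h) − β(d + |h|) ≤ log(1 + e^{−2β|h|}) ≤ e^{−2β|h|}`
  for `β ≥ 0`, and `pressure_le_abs_mul_add_log_two` — `ψ(β,h) ≤ |β|(d + |h|) + log 2`;
* **SATURATION IN THE FIELD**: `tendsto_pressure_sub_atTop_field` / `_atBot_field` — `ψ(β,h) − β(d + |h|) → 0` as
  `h → ±∞` (`β > 0`);
* **ZERO TEMPERATURE OFF `h = 0`**: `tendsto_pressure_sub_atTop_beta` — `ψ(β,h) − β(d + |h|) → 0` as `β → ∞` for every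
  `h ≠ 0`; for EVERY `h`: `tendsto_pressure_div_atTop_beta` — `ψ(β,h)/β → d + |h|` (the ground-state energy per site is
  `−(d + |h|)`), `tendsto_freeEnergy_atTop` — `f(β,h) = −ψ(β,h)/β → −(d + |h|)`.
(The case `h = 0` of the difference, `ψ(β,0) − βd → 0`, needs a Peierls count and is the sequel file
`PressureZeroTemperature`.)

## References

* S. Friedli, Y. Velenik, *Statistical Mechanics of Lattice Systems*, CUP (2017), §3.2.1 Def. 3.5 and footnote (free
  energy), Thm. 3.6 and its proof ("`ψ_Λ` is uniformly bounded (for example, by `2dβ + |h| + log 2`)"), Exercise 3.3.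
  [FriedliVelenik2017]
* B. Simon, *The Statistical Mechanics of Lattice Gases* I, Princeton (1993), §II.3 (ground states and the
  zero-temperature limit of the free energy). [Simon1993]
-/

noncomputable section

namespace Summit.CriticalPhenomena.PercolationContinuityZ3.Theorems.FK

namespace IsingPressure

open MeasureTheory Filter Topology Finset Set
open Literature.Probability.LatticeModels

variable {d : ℕ}

/-! ### `log (2 cosh x)` -/

/-- `2 cosh x = e^{|x|} (1 + e^{−2|x|})`. [folklore] -/
theorem two_mul_cosh_eq_exp_abs_mul (x : ℝ) : 2 * Real.cosh x = Real.exp |x| * (1 + Real.exp (-(2 * |x|))) := by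
  rw [← Real.cosh_abs, Real.cosh_eq, mul_add, mul_one, ← Real.exp_add]
  have : |x| + -(2 * |x|) = -|x| := by ring
  rw [this]
  ring

/-- `log (2 cosh x) = |x| + log (1 + e^{−2|x|})`. [folklore] -/
theorem log_two_mul_cosh_eq_abs_add (x : ℝ) :
    Real.log (2 * Real.cosh x) = |x| + Real.log (1 + Real.exp (-(2 * |x|))) := by
  rw [two_mul_cosh_eq_exp_abs_mul, Real.log_mul (Real.exp_pos _).ne' (by positivity), Real.log_exp]

/-- `|x| ≤ log (2 cosh x) ≤ |x| + e^{−2|x|}`. [folklore] -/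
theorem log_two_mul_cosh_mem_Icc (x : ℝ) :
    Real.log (2 * Real.cosh x) ∈ Icc |x| (|x| + Real.exp (-(2 * |x|))) := by
  rw [log_two_mul_cosh_eq_abs_add]
  have h0 : 0 ≤ Real.log (1 + Real.exp (-(2 * |x|))) := Real.log_nonneg (by linarith [Real.exp_pos (-(2 * |x|))])
  have h1 : Real.log (1 + Real.exp (-(2 * |x|))) ≤ Real.exp (-(2 * |x|)) := by
    have := Real.log_le_sub_one_of_pos (show 0 < 1 + Real.exp (-(2 * |x|)) by positivity)
    linarith
  exact ⟨by linarith, by linarith⟩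

/-- `log (2 cosh x) ≤ |x| + log 2`. [folklore] -/
theorem log_two_mul_cosh_le_abs_add_log_two (x : ℝ) : Real.log (2 * Real.cosh x) ≤ |x| + Real.log 2 := by
  rw [log_two_mul_cosh_eq_abs_add]
  have h1 : Real.exp (-(2 * |x|)) ≤ 1 := Real.exp_le_one_iff.2 (by linarith [abs_nonneg x])
  have := Real.log_le_log (by positivity : 0 < 1 + Real.exp (-(2 * |x|))) (show 1 + Real.exp (-(2 * |x|)) ≤ 2 by linarith)
  linarith

/-! ### Finite volume -/

section FiniteVolume

variable {V : Type*} (G : SimpleGraph V) [DecidableEq V] [G.LocallyFinite]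

/-- **The aligned configuration**: for the free boundary condition and all real `β`, `h`,
`exp(β (|E_Λ| + |h| |Λ|)) ≤ Z^∅_{Λ;β,h}` — the Boltzmann weight of the configuration `σ ≡ sign h` (every bond `+1`,
field term `|h||Λ|`) is one term of the partition sum. [cite: FriedliVelenik2017, Thm. 3.6 (proof) and Exercise 3.3] -/
theorem exp_mul_le_isingPartitionFunction_free (Λ : Finset V) (β h : ℝ) :
    Real.exp (β * (#(edgesIn G Λ) + |h| * #Λ)) ≤ isingPartitionFunction G Λ β h .free := by
  classical
  -- the aligned configuration
  set u : ℤˣ := if 0 ≤ h then 1 else -1 with hu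
  set τ₀ : Λ → ℤˣ := fun _ => u with hτ₀
  have hspin : ∀ x ∈ Λ, spinAt x (glue Λ τ₀ .free) = ((u : ℤ) : ℝ) := fun x hx => by
    simp [spinAt, hx, hτ₀]
  have huu : ((u : ℤ) : ℝ) * ((u : ℤ) : ℝ) = 1 := by
    rw [hu]; split_ifs <;> simp
  have hfield : h * ((u : ℤ) : ℝ) = |h| := by
    rw [hu]; split_ifs with hh
    · simp [abs_of_nonneg hh]
    · simp [abs_of_neg (not_le.1 hh)]
  have hbond : ∀ e ∈ edgesIn G Λ, bondSpin (glue Λ τ₀ .free) e = 1 := by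
    intro e he
    induction e using Sym2.ind with
    | _ x y =>
      have hx : x ∈ Λ := (mem_edgesIn_iff.1 he).2 x (Sym2.mem_mk_left x y)
      have hy : y ∈ Λ := (mem_edgesIn_iff.1 he).2 y (Sym2.mem_mk_right x y)
      rw [bondSpin_mk, hspin x hx, hspin y hy, huu]
  have hH : -isingHamiltonian G Λ h .free (glue Λ τ₀ .free) = #(edgesIn G Λ) + |h| * #Λ := by
    unfold isingHamiltonian
    rw [interactionEdges_free, sum_congr rfl hbond, sum_congr rfl hspin, sum_const, sum_const, nsmul_eq_mul,
      nsmul_eq_mul, mul_one, ← mul_assoc, mul_comm h, mul_assoc, hfield]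
    ring
  have hw : isingWeight G Λ β h .free τ₀ = Real.exp (β * (#(edgesIn G Λ) + |h| * #Λ)) := by
    rw [isingWeight, neg_mul, ← mul_neg, hH]
  rw [← hw]
  exact single_le_sum (f := fun τ => isingWeight G Λ β h .free τ) (fun τ _ => (isingWeight_pos G Λ β h .free τ).le)
    (mem_univ τ₀)

/-- `log Z^∅_{Λ;β,h} ≥ β (|E_Λ| + |h| |Λ|)` (all real `β`, `h`). [cite: FriedliVelenik2017, Thm. 3.6 (proof) and Exercise 3.3] -/
theorem mul_le_log_isingPartitionFunction_free (Λ : Finset V) (β h : ℝ) :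
    β * (#(edgesIn G Λ) + |h| * #Λ) ≤ Real.log (isingPartitionFunction G Λ β h .free) := by
  rw [← Real.log_exp (β * _)]
  exact Real.log_le_log (Real.exp_pos _) (exp_mul_le_isingPartitionFunction_free G Λ β h)

/-- **The field sum factorises**: `Σ_{τ : Λ → {±1}} exp(c Σ_{x∈Λ} (glue τ)_x) = (2 cosh c)^{|Λ|}`. [folklore] -/
theorem sum_exp_mul_sum_spinAt_glue (Λ : Finset V) (c : ℝ) (bc : BoundaryCondition V) :
    ∑ τ : Λ → ℤˣ, Real.exp (c * ∑ x ∈ Λ, spinAt x (glue Λ τ bc)) = (2 * Real.cosh c) ^ #Λ := by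
  classical
  have hsum : ∀ τ : Λ → ℤˣ, ∑ x ∈ Λ, spinAt x (glue Λ τ bc) = ∑ x : Λ, ((τ x : ℤ) : ℝ) := by
    intro τ
    rw [← sum_coe_sort Λ]
    exact sum_congr rfl fun x _ => by simp [spinAt]
  simp_rw [hsum, mul_sum, Real.exp_sum]
  rw [← Fintype.piFinset_univ, Finset.sum_prod_piFinset (univ : Finset ℤˣ) (fun (_ : Λ) (j : ℤˣ) => Real.exp (c * ((j : ℤ) : ℝ)))]
  rw [prod_const, card_univ, Fintype.card_coe]
  congr 1
  rw [UnitsInt.univ, sum_pair (by decide), Real.cosh_eq]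
  simp
  ring

/-- **`Z^{bc}_{Λ;β,h} ≤ e^{|β| |ℰ^{bc}_Λ|} (2 cosh βh)^{|Λ|}`** (bound the interaction by `|β||ℰ^{bc}_Λ|`, keep the field
exactly). [cite: FriedliVelenik2017, Thm. 3.6 (proof) and Exercise 3.3] -/
theorem isingPartitionFunction_le_exp_mul_cosh_pow (Λ : Finset V) (β h : ℝ) (bc : BoundaryCondition V) :
    isingPartitionFunction G Λ β h bc ≤
      Real.exp (|β| * #(interactionEdges G Λ bc)) * (2 * Real.cosh (β * h)) ^ #Λ := by
  rw [← sum_exp_mul_sum_spinAt_glue Λ (β * h) bc, mul_sum]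
  refine sum_le_sum fun τ _ => ?_
  rw [isingWeight, ← Real.exp_add]
  refine Real.exp_le_exp.2 ?_
  have hE : β * ∑ e ∈ interactionEdges G Λ bc, bondSpin (glue Λ τ bc) e ≤ |β| * #(interactionEdges G Λ bc) := by
    refine (le_abs_self _).trans ?_
    rw [abs_mul]
    exact mul_le_mul_of_nonneg_left (abs_sum_bondSpin_le _ _) (abs_nonneg β)
  have : -β * isingHamiltonian G Λ h bc (glue Λ τ bc) =
      β * ∑ e ∈ interactionEdges G Λ bc, bondSpin (glue Λ τ bc) e + β * h * ∑ x ∈ Λ, spinAt x (glue Λ τ bc) := by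
    unfold isingHamiltonian; ring
  rw [this]
  linarith

/-- **`log Z^{bc}_{Λ;β,h} ≤ |β| |ℰ^{bc}_Λ| + |Λ| log(2 cosh βh)`.** [cite: FriedliVelenik2017, Thm. 3.6 (proof) and Exercise 3.3] -/
theorem log_isingPartitionFunction_le_add_mul_log_cosh (Λ : Finset V) (β h : ℝ) (bc : BoundaryCondition V) :
    Real.log (isingPartitionFunction G Λ β h bc) ≤
      |β| * #(interactionEdges G Λ bc) + #Λ * Real.log (2 * Real.cosh (β * h)) := by
  have hc : 0 < 2 * Real.cosh (β * h) := by positivity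
  have := Real.log_le_log (isingPartitionFunction_pos G Λ β h bc) (isingPartitionFunction_le_exp_mul_cosh_pow G Λ β h bc)
  rwa [Real.log_mul (Real.exp_pos _).ne' (pow_pos hc _).ne', Real.log_exp, Real.log_pow] at this

/-- **`Z^{bc}_{Λ;0,h} = 2^{|Λ|}`** (at `β = 0` every configuration has weight `1`; the field enters as `βh`).
[cite: FriedliVelenik2017, Thm. 3.6 (proof)] -/
theorem isingPartitionFunction_zero_beta (Λ : Finset V) (h : ℝ) (bc : BoundaryCondition V) :
    isingPartitionFunction G Λ 0 h bc = 2 ^ #Λ := by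
  rw [isingPartitionFunction_eq_sum_exp]
  simp only [neg_zero, zero_mul, Real.exp_zero, sum_const, card_univ, card_spinConfig_coe, nsmul_eq_mul, mul_one]
  push_cast
  rfl

end FiniteVolume

/-! ### Infinite volume: `ψ(0,h) = log 2` and the two-sided bounds -/

/-- **LOWER BOUND `β (d + |h|) ≤ ψ(β,h)`** for all real `β`, `h` (the aligned configuration, `|E_{Λ_N}|/|Λ_N| → d`).
[cite: FriedliVelenik2017, Thm. 3.6 (proof) and Exercise 3.3] -/
theorem mul_add_abs_le_pressure (β h : ℝ) : β * (d + |h|) ≤ pressure d β h := by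
  have hlim : Tendsto (fun L : ℕ => pressureIn (zdGraph d) (box d L) β h .free) atTop (𝓝 (pressure d β h)) :=
    hasBoxLimit_pressureIn_holds (d := d) β h .free
  have hlow : Tendsto (fun L : ℕ => β * ((#(edgesIn (zdGraph d) (box d L)) : ℝ) / #(box d L) + |h|)) atTop
      (𝓝 (β * (d + |h|))) :=
    ((tendsto_card_edgesIn_box_div_card_box (d := d)).add tendsto_const_nhds).const_mul β
  refine le_of_tendsto_of_tendsto' hlow hlim fun L => ?_
  have hpos : (0 : ℝ) < #(box d L) := by exact_mod_cast (box_nonempty d L).card_pos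
  rw [pressureIn, le_div_iff₀ hpos]
  have := mul_le_log_isingPartitionFunction_free (zdGraph d) (box d L) β h
  calc β * ((#(edgesIn (zdGraph d) (box d L)) : ℝ) / #(box d L) + |h|) * #(box d L)
      = β * (#(edgesIn (zdGraph d) (box d L)) + |h| * #(box d L)) := by field_simp
    _ ≤ _ := this

/-- **UPPER BOUND `ψ(β,h) ≤ |β| d + log(2 cosh(βh))`** for all real `β`, `h` (`|E_Λ| ≤ d |Λ|`).
[cite: FriedliVelenik2017, Thm. 3.6 (proof) and Exercise 3.3] -/
theorem pressure_le_add_log_cosh (β h : ℝ) : pressure d β h ≤ |β| * d + Real.log (2 * Real.cosh (β * h)) := by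
  have hlim : Tendsto (fun L : ℕ => pressureIn (zdGraph d) (box d L) β h .free) atTop (𝓝 (pressure d β h)) :=
    hasBoxLimit_pressureIn_holds (d := d) β h .free
  refine le_of_tendsto' hlim fun L => ?_
  have hpos : (0 : ℝ) < #(box d L) := by exact_mod_cast (box_nonempty d L).card_pos
  rw [pressureIn, div_le_iff₀ hpos]
  have h1 := log_isingPartitionFunction_le_add_mul_log_cosh (zdGraph d) (box d L) β h .free
  have h2 : (#(interactionEdges (zdGraph d) (box d L) .free) : ℝ) ≤ d * #(box d L) := by
    rw [interactionEdges_free]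
    exact_mod_cast card_edgesIn_le_mul_card (d := d) (box d L)
  nlinarith [abs_nonneg β, Real.log_nonneg (show (1 : ℝ) ≤ 2 * Real.cosh (β * h) by nlinarith [Real.one_le_cosh (β * h)])]

/-- **`ψ(β,h) ≤ |β| (d + |h|) + log 2`** (Friedli–Velenik: "`ψ_Λ` is uniformly bounded (for example, by
`2dβ + |h| + log 2`)" — here with the sharp constants). [cite: FriedliVelenik2017, Thm. 3.6 (proof)] -/
theorem pressure_le_abs_mul_add_log_two (β h : ℝ) : pressure d β h ≤ |β| * (d + |h|) + Real.log 2 := by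
  have h1 := pressure_le_add_log_cosh (d := d) β h
  have h2 := log_two_mul_cosh_le_abs_add_log_two (β * h)
  rw [abs_mul] at h2
  nlinarith [abs_nonneg β, abs_nonneg h]

/-- **`0 ≤ ψ(β,h) − β(d + |h|) ≤ log(1 + e^{−2β|h|})`** for `β ≥ 0`: the pressure sits within `log(1 + e^{−2β|h|})` of the
ground-state value `β(d + |h|)`. [cite: FriedliVelenik2017, Thm. 3.6 (proof) and Exercise 3.3; Simon1993, §II.3] -/
theorem pressure_sub_mem_Icc {β : ℝ} (hβ : 0 ≤ β) (h : ℝ) :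
    pressure d β h - β * (d + |h|) ∈ Icc 0 (Real.log (1 + Real.exp (-(2 * (β * |h|))))) := by
  refine ⟨sub_nonneg.2 (mul_add_abs_le_pressure β h), ?_⟩
  have h1 := pressure_le_add_log_cosh (d := d) β h
  rw [log_two_mul_cosh_eq_abs_add, abs_mul, abs_of_nonneg hβ] at h1
  linarith

/-- `ψ(β,h) − β(d + |h|) ≤ e^{−2β|h|}` for `β ≥ 0`. [cite: FriedliVelenik2017, Thm. 3.6 (proof) and Exercise 3.3] -/
theorem pressure_sub_le_exp {β : ℝ} (hβ : 0 ≤ β) (h : ℝ) :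
    pressure d β h - β * (d + |h|) ≤ Real.exp (-(2 * (β * |h|))) := by
  have h1 := pressure_le_add_log_cosh (d := d) β h
  have h2 := (log_two_mul_cosh_mem_Icc (β * h)).2
  rw [abs_mul, abs_of_nonneg hβ] at h2
  rw [abs_of_nonneg hβ] at h1
  linarith

/-- `0 ≤ ψ(β,h) − β(d + |h|) ≤ log 2` for `β ≥ 0`. [cite: FriedliVelenik2017, Thm. 3.6 (proof)] -/
theorem pressure_sub_mem_Icc_log_two {β : ℝ} (hβ : 0 ≤ β) (h : ℝ) :
    pressure d β h - β * (d + |h|) ∈ Icc 0 (Real.log 2) := by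
  refine ⟨(pressure_sub_mem_Icc hβ h).1, ?_⟩
  have := pressure_le_abs_mul_add_log_two (d := d) β h
  rw [abs_of_nonneg hβ] at this
  linarith

/-! ### Saturation in the field: `ψ(β,h) − β(d + |h|) → 0` as `h → ±∞` -/

/-- **`ψ(β,h) − β(d + |h|) → 0` as `h → +∞`** (`β > 0`). [cite: FriedliVelenik2017, Exercise 3.3 and §3.2.1] -/
theorem tendsto_pressure_sub_atTop_field {β : ℝ} (hβ : 0 < β) :
    Tendsto (fun h => pressure d β h - β * (d + |h|)) atTop (𝓝 0) := by
  have hexp : Tendsto (fun h : ℝ => Real.exp (-(2 * (β * |h|)))) atTop (𝓝 0) := by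
    refine Real.tendsto_exp_atBot.comp ?_
    refine tendsto_neg_atTop_atBot.comp ?_
    refine (tendsto_abs_atTop_atTop.const_mul_atTop hβ).const_mul_atTop two_pos
  exact tendsto_of_tendsto_of_tendsto_of_le_of_le tendsto_const_nhds hexp
    (fun h => (pressure_sub_mem_Icc hβ.le h).1) fun h => pressure_sub_le_exp hβ.le h

/-- **`ψ(β,h) − β(d + |h|) → 0` as `h → −∞`** (`β > 0`). [cite: FriedliVelenik2017, Exercise 3.3 and §3.7.1] -/
theorem tendsto_pressure_sub_atBot_field {β : ℝ} (hβ : 0 < β) :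
    Tendsto (fun h => pressure d β h - β * (d + |h|)) atBot (𝓝 0) := by
  have hexp : Tendsto (fun h : ℝ => Real.exp (-(2 * (β * |h|)))) atBot (𝓝 0) := by
    refine Real.tendsto_exp_atBot.comp ?_
    refine tendsto_neg_atTop_atBot.comp ?_
    refine (tendsto_abs_atBot_atTop.const_mul_atTop hβ).const_mul_atTop two_pos
  exact tendsto_of_tendsto_of_tendsto_of_le_of_le tendsto_const_nhds hexp
    (fun h => (pressure_sub_mem_Icc hβ.le h).1) fun h => pressure_sub_le_exp hβ.le h

/-! ### Zero temperature: `ψ(β,h) − β(d + |h|) → 0` (`h ≠ 0`), `ψ(β,h)/β → d + |h|`, `f(β,h) → −(d + |h|)` -/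

/-- **`ψ(β,h) − β(d + |h|) → 0` as `β → ∞` for every `h ≠ 0`** (the exponentially small correction `e^{−2β|h|}`). The case
`h = 0` (`ψ(β,0) − βd → 0`) is `PressureZeroTemperature`. [cite: Simon1993, §II.3; FriedliVelenik2017, Exercise 3.3] -/
theorem tendsto_pressure_sub_atTop_beta {h : ℝ} (hh : h ≠ 0) :
    Tendsto (fun β => pressure d β h - β * (d + |h|)) atTop (𝓝 0) := by
  have habs : 0 < |h| := abs_pos.2 hh
  have hexp : Tendsto (fun β : ℝ => Real.exp (-(2 * (β * |h|)))) atTop (𝓝 0) := by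
    refine Real.tendsto_exp_atBot.comp (tendsto_neg_atTop_atBot.comp ?_)
    exact (tendsto_id.atTop_mul_const habs).const_mul_atTop two_pos
  refine tendsto_of_tendsto_of_tendsto_of_le_of_le' tendsto_const_nhds hexp ?_ ?_
  · filter_upwards [eventually_ge_atTop 0] with β hβ using (pressure_sub_mem_Icc hβ h).1
  · filter_upwards [eventually_ge_atTop 0] with β hβ using pressure_sub_le_exp hβ h

/-- **`ψ(β,h)/β → d + |h|` as `β → ∞`, for EVERY `h`** (`0 ≤ ψ − β(d+|h|) ≤ log 2`): minus the ground-state energy per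
site of the nearest-neighbour Ising model on `ℤ^d` in the field `h`. [cite: Simon1993, §II.3; FriedliVelenik2017, §3.2.1 and Exercise 3.3] -/
theorem tendsto_pressure_div_atTop_beta (h : ℝ) :
    Tendsto (fun β => pressure d β h / β) atTop (𝓝 (d + |h|)) := by
  have hcorr : Tendsto (fun β => (pressure d β h - β * (d + |h|)) / β) atTop (𝓝 0) := by
    have hup : Tendsto (fun β : ℝ => Real.log 2 / β) atTop (𝓝 0) := tendsto_const_nhds.div_atTop tendsto_id
    refine tendsto_of_tendsto_of_tendsto_of_le_of_le' tendsto_const_nhds hup ?_ ?_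
    · filter_upwards [eventually_gt_atTop 0] with β hβ using div_nonneg (pressure_sub_mem_Icc_log_two hβ.le h).1 hβ.le
    · filter_upwards [eventually_gt_atTop 0] with β hβ using
        div_le_div_of_nonneg_right (pressure_sub_mem_Icc_log_two hβ.le h).2 hβ.le
  have := hcorr.add_const ((d : ℝ) + |h|)
  rw [zero_add] at this
  refine this.congr' ?_
  filter_upwards [eventually_gt_atTop 0] with β hβ
  field_simp
  ring

/-- **`f(β,h) = −ψ(β,h)/β → −(d + |h|)` as `β → ∞`** (the free energy per site tends to the ground-state energy per
site). [cite: FriedliVelenik2017, §3.2.1 (footnote to Def. 3.5); Simon1993, §II.3] -/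
theorem tendsto_freeEnergy_atTop (h : ℝ) :
    Tendsto (fun β => freeEnergy d β h) atTop (𝓝 (-(d + |h|))) := by
  have := (tendsto_pressure_div_atTop_beta (d := d) h).neg
  refine this.congr fun β => ?_
  rw [freeEnergy, neg_div]

/-- **Continuity at infinite temperature**: `ψ(β,h) → log 2 = ψ(0,h)` as `β → 0` (every `h`; the value at `β = 0` is the
tree's `pressure_zero_beta` of `PlanarIsingPressure`, re-derived inline from `Z_{Λ;0,h} = 2^{|Λ|}`).
[cite: FriedliVelenik2017, Thm. 3.6] -/
theorem tendsto_pressure_nhds_zero_beta (h : ℝ) : Tendsto (fun β => pressure d β h) (𝓝 0) (𝓝 (Real.log 2)) := by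
  have hval : pressure d 0 h = Real.log 2 := by
    have hlim : Tendsto (fun L : ℕ => pressureIn (zdGraph d) (box d L) 0 h .free) atTop (𝓝 (pressure d 0 h)) :=
      hasBoxLimit_pressureIn_holds (d := d) 0 h .free
    refine tendsto_nhds_unique hlim (tendsto_const_nhds.congr fun L => ?_)
    have hpos : (0 : ℝ) < #(box d L) := by exact_mod_cast (box_nonempty d L).card_pos
    rw [pressureIn, isingPartitionFunction_zero_beta, Real.log_pow]
    field_simp
  have := (IsingEnergyDensity.continuous_pressure_beta (d := d) h).tendsto 0
  rwa [hval] at this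

end IsingPressure

end Summit.CriticalPhenomena.PercolationContinuityZ3.Theorems.FK

end
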